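import Literature.Barriers.ValiantsHypothesis.BILPS19HMinRank1NPHardProofs
import Literature.Barriers.ValiantsHypothesis.BILPS19HMinRank1ToHQuadProofs
import Literature.Computability.AlgebraicComplexity.BILPS19OrbitClosureCor20Proofs
import HarnessLib

/-!
# Bläser–Ikenmeyer–Lysikov–Pandey–Schreyer 2019, Cor 37: orbit closure containment is NP-hard —
# proofs

Sibling proof file of `BILPS19MembershipHardness.lean` (val-lit X5-BILPS19, §8). Discharges the named
fact `BILPS2019_cor37 F : IsNPHard (occLanguage F)` — BILPS Cor 37: "Given two tensors `t` and `t'`,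
deciding whether the orbit closure of `t` is contained in the orbit closure of `t'` (under the usual
`GL_n × GL_n × GL_n` action) is NP-hard." (arXiv:1911.02534 p0034:L38–40) — for every algebraically
closed field `F` (the statement file types it with `[IsAlgClosed F] [CharZero F]`; the characteristic
plays no role in this file).

PRINTED PROOF (p0034:L35–36, the whole of it): "From the facts that the minrank problem is NP-hard
and that minrank varieties can be written as orbit closures, we immediately get the following
hardness result for the orbit closure containment problem." This file follows that sentence, with
the two inputs taken from the tree:

* "the minrank problem is NP-hard": the tree's `BILPS2019_cor35_holds` (BILPS Cor 35, `HMinRank1`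
  is NP-hard, EVERY field; `BILPS19HMinRank1NPHardProofs.lean`). DISCLOSED CHOICE: the print places
  Cor 37 right after Thm 36 (the shapes `n × (2n+1) × (2n+1)`, `r = n+1`, characteristic `0`,
  the separate fact `BILPS2019_thm36`); the sentence quoted above needs ANY NP-hard minrank problem,
  and Cor 35 (`r = 1`, same §8.2) is the one already proved in the tree, so the source problem of the
  reduction below is `hmr1Language F` (Problem 3). Nothing else changes.
* "minrank varieties can be written as orbit closures": BILPS Thm 19 / Cor 20 (`𝓜_r ∩ (U ⊗ V ⊗ L) =
  \overline{GL·T_{k,n,r}} ∩ (U ⊗ V ⊗ L)`), proved in the tree by t21's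
  `BILPS19OrbitClosureCor20Proofs.lean` (`BILPS2019Cor20.exists_actTensor_bilpsTensor_eq`,
  `…trilinearPt_actTensor_mem_orbitClosure3`, x2's Thm 14 `BILPS2019Thm14.…`).

WHAT THE ONE-LINE PRINTED PROOF LEAVES IMPLICIT, and this file supplies (all elementary):

1. The statement file types Cor 37 for CUBIC tensors `t, t' ∈ F^{N×N×N}` under `GL_N³` (as printed:
   "the usual `GL_n × GL_n × GL_n` action"), whereas Thm 19 describes `𝓜_r` inside the format
   `U ⊗ L ⊗ L`, `dim U = k`, `dim L = s = (k-1)n + r`. §1 proves that orbit-closure membership is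
   INSENSITIVE TO ZERO-PADDING of the three legs (`BILPS2019Cor37.trilinearPt_actTensor_mem_orbitClosure3_iff`:
   for matrices `P, Q, R` with left inverses, `(P ⊗ Q ⊗ R)T ∈ \overline{GL'³ (P ⊗ Q ⊗ R)T₀}` iff
   `T ∈ \overline{GL³ T₀}` — push-forward by writing `P g = (P g P')P`, pull-back by the retraction
   `P'`, both through the tree's `End³`-stability of orbit closures), and that CONTAINMENT of orbit
   closures is membership of the point (`orbitClosure3_subset_iff`).
2. For ONE slice (`k = 1`) Thm 19 as printed is void when `n > r` (`V ≤ L = F^r` is impossible); the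
   classical description `{A : rk A ≤ r} = \overline{GL·E_r}` is proved directly
   (`oneSlice_mem_minrankSet_iff`, rank factorisation `KumarVolk2020.exists_mul_eq_of_rank_le`).
3. The Karp map on codes (§7–§8): an `HMinRank1` instance `(n, k, entries, 1)` with `k ≥ 1` goes to
   the cube size `N = k n + 1` and the two cubes `t = ` the slices `A_1, …, A_k` zero-padded into
   `F^{N×N×N}`, `t' =` the zero-padded `T_{k,n,1}` (slice `0`: the unit `E_{00}`; slice `a ∈ [1,k)`:
   the identity on the coordinate block `[1 + (a-1)n, 1 + an)`), written by one table loop on t20's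
   `BILPS19Thm34.karpReducible_of_decoder` template (decoder `decT`, guard `guardA` reused verbatim);
   ill-formed codes, `r ≠ 1` and `k = 0` go to the fixed non-member `(1, [], [])`.

Main results: `BILPS2019Cor37.mem_minrankSet_iff_orbitClosure3_padCube_subset` (the geometric
dictionary, any `k ≥ 1`, any `r`), `BILPS2019Cor37.hmr1Language_karpReducible_occLanguage :
hmr1Language F ≤ₚ occLanguage F`, `BILPS2019Cor37.occLanguage_isNPHard` (every algebraically closed
`F`, no characteristic hypothesis), and **`BILPS2019_cor37_holds : BILPS2019_cor37 F`**.

Theorem-only file (its `def`s are proof plumbing: padding maps, tables, the instance map; no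
statement of `BILPS19MembershipHardness.lean` is touched, no new fact). HONEST FRAMING (val-lit):
a published 2019 NP-hardness result about orbit-closure containment of 3-tensors, re-assembled over
tree lemmas; it is NOT about `VP`, and `VP ≠ VNP` is NOT proved — nothing here is progress on it.

## References

* [BlaserIkenmeyerLysikovPandeySchreyer2019] M. Bläser, C. Ikenmeyer, V. Lysikov, A. Pandey,
  F.-O. Schreyer, *Variety membership testing, algebraic natural proofs, and geometric complexity
  theory*, arXiv:1911.02534, §6.1 (Thm. 19, Cor. 20, p0023:L80–p0024:L10), §8.2 (Problems 2–3,
  Cor. 35 p0033:L95, Cor. 37 p0034:L35–40).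
* [AroraBarak2009] S. Arora, B. Barak, *Computational Complexity: A Modern Approach*, CUP 2009,
  Def. 2.7 (Karp reductions), §1.3 (polynomial time: composition, bounded loops).
-/

noncomputable section

namespace Literature.Barriers.ValiantsHypothesis

open Literature.Computability.AlgebraicComplexity Literature.Computability.Complexity MvPolynomial
open _root_.Computability Matrix
open scoped Literature.Computability.Complexity.Notation

universe u

namespace BILPS2019Cor37

/-! ### §1. Orbit closures under linear maps of the three legs (zero-padding and retraction) -/

section Functoriality

variable {F : Type*} [Field F] {ι κ μ ι' κ' μ' : Type*}
variable [Fintype ι] [Fintype κ] [Fintype μ]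

/-- A polynomial test on `(A ⊗ B ⊗ C)·T` is a polynomial test on `T`, for RECTANGULAR `A, B, C`
(the coordinates of `(A ⊗ B ⊗ C)·T` are linear forms in those of `T`).
[cite: BlaserIkenmeyerLysikovPandeySchreyer2019, §1.1 (the standard action on U ⊗ V ⊗ W)] -/
theorem aeval_trilinearPt_actTensor_rect (A : Matrix ι' ι F) (B : Matrix κ' κ F) (C : Matrix μ' μ F)
    (T : ι → κ → μ → F) (p : MvPolynomial (ι' × κ' × μ') F) :
    aeval (trilinearPt (actTensor A B C T)) p =
      aeval (trilinearPt T)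
        (aeval (fun q : ι' × κ' × μ' => ∑ a', ∑ b', ∑ c',
          MvPolynomial.C (A q.1 a' * B q.2.1 b' * C q.2.2 c') * X (a', b', c')) p) := by
  have hfun : trilinearPt (actTensor A B C T) = fun q : ι' × κ' × μ' =>
      aeval (trilinearPt T) (∑ a', ∑ b', ∑ c',
        MvPolynomial.C (A q.1 a' * B q.2.1 b' * C q.2.2 c') * X (a', b', c')) := by
    funext q
    simp only [trilinearPt, actTensor_apply, map_sum, map_mul, aeval_C, aeval_X,
      Algebra.algebraMap_self, RingHom.id_apply]
  rw [← AlgHom.comp_apply, MvPolynomial.comp_aeval, hfun]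

variable [Fintype ι'] [Fintype κ'] [Fintype μ']
variable [DecidableEq ι] [DecidableEq κ] [DecidableEq μ] [DecidableEq ι'] [DecidableEq κ'] [DecidableEq μ']

/-- **Push-forward along injective leg maps.** If `P, Q, R` have left inverses and the point of `T`
lies in the orbit closure of `T₀`, then the point of `(P ⊗ Q ⊗ R)T` lies in the orbit closure of
`(P ⊗ Q ⊗ R)T₀`: a test vanishing on the `GL'³`-orbit of `(P ⊗ Q ⊗ R)T₀` pulls back to a test
vanishing on the `GL³`-orbit of `T₀`, because `(P g ⊗ Q h ⊗ R i)T₀ = (P g P' ⊗ Q h Q' ⊗ R i R')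
(P ⊗ Q ⊗ R)T₀` is an `End'³`-degeneration (tree: `trilinearPt_actTensor_mem_orbitClosure3_of_end`).
[cite: BlaserIkenmeyerLysikovPandeySchreyer2019, Cor. 20 (proof: degenerations lie in the orbit closure)] -/
theorem trilinearPt_actTensor_mem_orbitClosure3_actTensor [Infinite F] {P : Matrix ι' ι F}
    {Q : Matrix κ' κ F} {R : Matrix μ' μ F} {P' : Matrix ι ι' F} {Q' : Matrix κ κ' F}
    {R' : Matrix μ μ' F} (hP : P' * P = 1) (hQ : Q' * Q = 1) (hR : R' * R = 1)
    {T₀ T : ι → κ → μ → F} (h : trilinearPt T ∈ orbitClosure3 T₀) :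
    trilinearPt (actTensor P Q R T) ∈ orbitClosure3 (actTensor P Q R T₀) := by
  rw [orbitClosure3, mem_zariskiClosure_iff] at h ⊢
  intro p hp
  rw [aeval_trilinearPt_actTensor_rect]
  refine h _ fun y hy => ?_
  obtain ⟨T', ⟨gA, gB, gC, rfl⟩, rfl⟩ := hy
  rw [← aeval_trilinearPt_actTensor_rect, actTensor_actTensor]
  have hfac : actTensor (P * (gA : Matrix ι ι F)) (Q * (gB : Matrix κ κ F)) (R * (gC : Matrix μ μ F)) T₀ =
      actTensor (P * (gA : Matrix ι ι F) * P') (Q * (gB : Matrix κ κ F) * Q')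
        (R * (gC : Matrix μ μ F) * R') (actTensor P Q R T₀) := by
    rw [actTensor_actTensor, Matrix.mul_assoc _ P', hP, Matrix.mul_one, Matrix.mul_assoc _ Q', hQ,
      Matrix.mul_one, Matrix.mul_assoc _ R', hR, Matrix.mul_one]
  rw [hfac]
  have hmem := BILPS2019Cor20.trilinearPt_actTensor_mem_orbitClosure3_of_end (actTensor P Q R T₀)
    (P * (gA : Matrix ι ι F) * P') (Q * (gB : Matrix κ κ F) * Q') (R * (gC : Matrix μ μ F) * R')
  rw [orbitClosure3, mem_zariskiClosure_iff] at hmem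
  exact hmem p hp

/-- **Pull-back along arbitrary leg maps.** If the point of `S` lies in the orbit closure of
`(P ⊗ Q ⊗ R)T₀`, then for ARBITRARY matrices `M, N, O` back to the format of `T₀` the point of
`(M ⊗ N ⊗ O)S` lies in the orbit closure of `T₀` (the orbit of `(P ⊗ Q ⊗ R)T₀` is mapped into the
`End³`-degenerations `(M g P ⊗ N h Q ⊗ O i R)T₀` of `T₀`).
[cite: BlaserIkenmeyerLysikovPandeySchreyer2019, Cor. 20 (proof: degenerations lie in the orbit closure)] -/
theorem trilinearPt_actTensor_mem_orbitClosure3_of_mem_actTensor [Infinite F] (P : Matrix ι' ι F)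
    (Q : Matrix κ' κ F) (R : Matrix μ' μ F) (M : Matrix ι ι' F) (N : Matrix κ κ' F)
    (O : Matrix μ μ' F) {T₀ : ι → κ → μ → F} {S : ι' → κ' → μ' → F}
    (h : trilinearPt S ∈ orbitClosure3 (actTensor P Q R T₀)) :
    trilinearPt (actTensor M N O S) ∈ orbitClosure3 T₀ := by
  rw [orbitClosure3, mem_zariskiClosure_iff] at h ⊢
  intro p hp
  rw [aeval_trilinearPt_actTensor_rect]
  refine h _ fun y hy => ?_
  obtain ⟨T', ⟨gA, gB, gC, rfl⟩, rfl⟩ := hy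
  rw [← aeval_trilinearPt_actTensor_rect, actTensor_actTensor, actTensor_actTensor]
  have hmem := BILPS2019Cor20.trilinearPt_actTensor_mem_orbitClosure3_of_end T₀
    (M * (gA : Matrix ι' ι' F) * P) (N * (gB : Matrix κ' κ' F) * Q) (O * (gC : Matrix μ' μ' F) * R)
  rw [orbitClosure3, mem_zariskiClosure_iff] at hmem
  exact hmem p hp

/-- **Orbit-closure membership is insensitive to zero-padding of the three legs**: for `P, Q, R`
with left inverses, `(P ⊗ Q ⊗ R)T ∈ \overline{GL'³·(P ⊗ Q ⊗ R)T₀}` iff `T ∈ \overline{GL³·T₀}`.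
[cite: BlaserIkenmeyerLysikovPandeySchreyer2019, Cor. 37 (proof: "minrank varieties can be written as orbit closures", read in the cubic format)] -/
theorem trilinearPt_actTensor_mem_orbitClosure3_iff [Infinite F] {P : Matrix ι' ι F}
    {Q : Matrix κ' κ F} {R : Matrix μ' μ F} {P' : Matrix ι ι' F} {Q' : Matrix κ κ' F}
    {R' : Matrix μ μ' F} (hP : P' * P = 1) (hQ : Q' * Q = 1) (hR : R' * R = 1)
    (T₀ T : ι → κ → μ → F) :
    trilinearPt (actTensor P Q R T) ∈ orbitClosure3 (actTensor P Q R T₀) ↔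
      trilinearPt T ∈ orbitClosure3 T₀ := by
  refine ⟨fun h => ?_, trilinearPt_actTensor_mem_orbitClosure3_actTensor hP hQ hR⟩
  have h1 := trilinearPt_actTensor_mem_orbitClosure3_of_mem_actTensor P Q R P' Q' R' h
  rwa [actTensor_actTensor, hP, hQ, hR, actTensor_one] at h1

omit [Fintype ι'] [Fintype κ'] [Fintype μ'] [DecidableEq ι'] [DecidableEq κ'] [DecidableEq μ'] in
/-- **Containment of orbit closures is membership of the point**: `\overline{GL³·S} ⊆ \overline{GL³·S₀}`
iff the point of `S` lies in `\overline{GL³·S₀}` ("when `t` lies in the closure of `t'`, then the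
whole orbit closure of `t` is contained in the closure of `t'`", §1.1 p0004:L9; by the
`End³`-stability of orbit closures). [cite: BlaserIkenmeyerLysikovPandeySchreyer2019, §1.1 (p0004:L9–10)] -/
theorem orbitClosure3_subset_iff [Infinite F] (S S₀ : ι → κ → μ → F) :
    orbitClosure3 S ⊆ orbitClosure3 S₀ ↔ trilinearPt S ∈ orbitClosure3 S₀ := by
  refine ⟨fun h => h (trilinearPt_mem_orbitClosure3 (mem_glOrbit3_self S)), fun h => ?_⟩
  have hsub : trilinearPt '' glOrbit3 S ⊆ orbitClosure3 S₀ := by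
    rintro _ ⟨_, ⟨A, B, C, rfl⟩, rfl⟩
    exact BILPS2019Cor20.trilinearPt_actTensor_mem_orbitClosure3_of_mem h _ _ _
  intro x hx
  have hx' := zariskiClosure_mono hsub hx
  rwa [orbitClosure3, zariskiClosure_zariskiClosure] at hx'

end Functoriality

/-! ### §2. Zero-padding matrices of injective maps -/

section Embedding

variable {F : Type*} [Field F] {α β γ : Type*}

/-- The `0/1` matrix of a map `e : α → β` (column `a` is the standard vector `e_{e a}`): for `e`
injective, left multiplication zero-pads a vector along `e`. [folklore] -/
def embMatrix (F : Type*) [Field F] [DecidableEq β] (e : α → β) : Matrix β α F :=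
  Matrix.of fun b a => if e a = b then 1 else 0

/-- Entries of `embMatrix`. [folklore] -/
private theorem embMatrix_apply [DecidableEq β] (e : α → β) (b : β) (a : α) :
    embMatrix F e b a = if e a = b then 1 else 0 := rfl

/-- `embMatrix f * embMatrix g = embMatrix (f ∘ g)`. [folklore] -/
private theorem embMatrix_mul_embMatrix [Fintype β] [DecidableEq β] [DecidableEq γ] (f : β → γ) (g : α → β) :
    embMatrix F f * embMatrix F g = embMatrix F (f ∘ g) := by
  ext c a
  rw [Matrix.mul_apply, Finset.sum_eq_single (g a)]
  · simp [embMatrix_apply]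
  · intro b _ hb
    rw [embMatrix_apply, embMatrix_apply, if_neg (Ne.symm hb), mul_zero]
  · intro h; exact absurd (Finset.mem_univ _) h

/-- The transpose of the padding matrix of an injective map is a left inverse (a retraction).
[folklore] -/
private theorem embMatrix_transpose_mul_self [Fintype β] [DecidableEq α] [DecidableEq β] {e : α → β}
    (he : Function.Injective e) :
    (embMatrix F e)ᵀ * embMatrix F e = 1 := by
  ext a a'
  rw [Matrix.mul_apply, Finset.sum_eq_single (e a')]
  · simp only [Matrix.transpose_apply, embMatrix_apply, if_true, mul_one, he.eq_iff, Matrix.one_apply]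
  · intro b _ hb
    rw [embMatrix_apply, if_neg (Ne.symm hb), mul_zero]
  · intro h; exact absurd (Finset.mem_univ _) h

/-- The padding matrix of the identity map is `1`. [folklore] -/
private theorem embMatrix_id [DecidableEq α] : embMatrix F (id : α → α) = 1 := by
  ext a b
  simp only [embMatrix_apply, id_eq, Matrix.one_apply]
  by_cases h : a = b
  · rw [if_pos h.symm, if_pos h]
  · rw [if_neg fun h' => h h'.symm, if_neg h]

/-- The padding matrices of an equivalence and of its inverse are mutually inverse. [folklore] -/
private theorem embMatrix_symm_mul_embMatrix [Fintype α] [Fintype β] [DecidableEq α] [DecidableEq β]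
    (e : α ≃ β) : embMatrix F e.symm * embMatrix F e = 1 := by
  rw [embMatrix_mul_embMatrix, Equiv.symm_comp_self, embMatrix_id]

variable {ι κ μ ι' κ' μ' : Type*} [Fintype ι] [Fintype κ] [Fintype μ]

/-- **Entries of a zero-padded tensor at image points**: `((E₁ ⊗ E₂ ⊗ E₃)T)_{e₁ a, e₂ b, e₃ c} =
T_{abc}` for injective `e₁, e₂, e₃`. [folklore] -/
private theorem actTensor_embMatrix_apply_image [DecidableEq ι'] [DecidableEq κ'] [DecidableEq μ']
    {e₁ : ι → ι'} {e₂ : κ → κ'} {e₃ : μ → μ'} (h₁ : Function.Injective e₁)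
    (h₂ : Function.Injective e₂) (h₃ : Function.Injective e₃) (T : ι → κ → μ → F) (a : ι) (b : κ)
    (c : μ) :
    actTensor (embMatrix F e₁) (embMatrix F e₂) (embMatrix F e₃) T (e₁ a) (e₂ b) (e₃ c) = T a b c := by
  rw [actTensor_apply, Finset.sum_eq_single a, Finset.sum_eq_single b, Finset.sum_eq_single c]
  · simp [embMatrix_apply]
  · intro c' _ hc'; simp [embMatrix_apply, h₃.ne hc']
  · intro h; exact absurd (Finset.mem_univ _) h
  · intro b' _ hb'; simp [embMatrix_apply, h₂.ne hb']
  · intro h; exact absurd (Finset.mem_univ _) h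
  · intro a' _ ha'; simp [embMatrix_apply, h₁.ne ha']
  · intro h; exact absurd (Finset.mem_univ _) h

/-- **Entries of a zero-padded tensor off the image are `0`.** [folklore] -/
private theorem actTensor_embMatrix_apply_eq_zero [DecidableEq ι'] [DecidableEq κ'] [DecidableEq μ']
    (e₁ : ι → ι') (e₂ : κ → κ') (e₃ : μ → μ') (T : ι → κ → μ → F) {a' : ι'} {b' : κ'} {c' : μ'}
    (h : (∀ a, e₁ a ≠ a') ∨ (∀ b, e₂ b ≠ b') ∨ (∀ c, e₃ c ≠ c')) :
    actTensor (embMatrix F e₁) (embMatrix F e₂) (embMatrix F e₃) T a' b' c' = 0 := by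
  simp only [actTensor_apply, embMatrix_apply]
  refine Finset.sum_eq_zero fun a _ => Finset.sum_eq_zero fun b _ => Finset.sum_eq_zero fun c _ => ?_
  rcases h with h | h | h
  · rw [if_neg (h a)]; simp
  · rw [if_neg (h b)]; simp
  · rw [if_neg (h c)]; simp

end Embedding

/-! ### §3. Transport of the minrank variety along padded legs -/

section MinrankTransport

variable {F : Type*} [Field F] {ι κ μ ι' κ' μ' : Type*}
variable [Fintype ι] [Fintype κ] [Fintype μ] [Fintype ι'] [Fintype κ'] [Fintype μ']

/-- Reversal of a fourfold finite sum. [folklore] -/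
private theorem sum_rev4 (f : ι' → ι → κ → μ → F) :
    ∑ a', ∑ a, ∑ b, ∑ c, f a' a b c = ∑ c, ∑ b, ∑ a, ∑ a', f a' a b c :=
  calc ∑ a', ∑ a, ∑ b, ∑ c, f a' a b c = ∑ a', ∑ a, ∑ c, ∑ b, f a' a b c :=
        Finset.sum_congr rfl fun _ _ => Finset.sum_congr rfl fun _ _ => Finset.sum_comm
    _ = ∑ a', ∑ c, ∑ a, ∑ b, f a' a b c := Finset.sum_congr rfl fun _ _ => Finset.sum_comm
    _ = ∑ c, ∑ a', ∑ a, ∑ b, f a' a b c := Finset.sum_comm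
    _ = ∑ c, ∑ a', ∑ b, ∑ a, f a' a b c :=
        Finset.sum_congr rfl fun _ _ => Finset.sum_congr rfl fun _ _ => Finset.sum_comm
    _ = ∑ c, ∑ b, ∑ a', ∑ a, f a' a b c := Finset.sum_congr rfl fun _ _ => Finset.sum_comm
    _ = ∑ c, ∑ b, ∑ a, ∑ a', f a' a b c :=
        Finset.sum_congr rfl fun _ _ => Finset.sum_congr rfl fun _ _ => Finset.sum_comm

omit [Fintype κ'] [Fintype μ'] in
/-- **Slice identity for rectangular leg maps**: `((A ⊗ B ⊗ C)T) y = B · T(yA) · Cᵀ` (the printed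
"`(F ⊗ G ⊗ H)T · (F^{-*} x) = (G ⊗ H)(Tx)`" of Lemma 18, for arbitrary formats).
[cite: BlaserIkenmeyerLysikovPandeySchreyer2019, Lemma 18 (proof)] -/
theorem contract3_actTensor_rect (A : Matrix ι' ι F) (B : Matrix κ' κ F) (C : Matrix μ' μ F)
    (T : ι → κ → μ → F) (y : ι' → F) :
    contract3 (actTensor A B C T) y = B * contract3 T (Matrix.vecMul y A) * Cᵀ := by
  ext b' c'
  simp only [contract3_apply, actTensor_apply, Matrix.mul_apply, Matrix.transpose_apply,
    Matrix.vecMul, dotProduct, Finset.mul_sum, Finset.sum_mul]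
  rw [sum_rev4]
  exact Finset.sum_congr rfl fun _ _ => Finset.sum_congr rfl fun _ _ => Finset.sum_congr rfl
    fun _ _ => Finset.sum_congr rfl fun _ _ => by ring

variable [DecidableEq ι] [DecidableEq κ] [DecidableEq μ] [DecidableEq ι'] [DecidableEq κ'] [DecidableEq μ']

omit [Fintype ι] [Fintype ι'] [DecidableEq ι] [DecidableEq ι'] [DecidableEq κ'] [DecidableEq μ'] in
/-- Conjugating by matrices with left inverses does not change the rank. [folklore] -/
private theorem rank_mul_mul_transpose_eq {Q : Matrix κ' κ F} {R : Matrix μ' μ F} {Q' : Matrix κ κ' F}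
    {R' : Matrix μ μ' F} (hQ : Q' * Q = 1) (hR : R' * R = 1) (M : Matrix κ μ F) :
    (Q * M * Rᵀ).rank = M.rank := by
  refine le_antisymm ((Matrix.rank_mul_le_left _ _).trans (Matrix.rank_mul_le_right _ _)) ?_
  have h : Q' * (Q * M * Rᵀ) * R'ᵀ = M := by
    rw [← Matrix.mul_assoc, ← Matrix.mul_assoc, hQ, Matrix.one_mul, Matrix.mul_assoc,
      ← Matrix.transpose_mul, hR, Matrix.transpose_one, Matrix.mul_one]
  calc M.rank = (Q' * (Q * M * Rᵀ) * R'ᵀ).rank := by rw [h]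
    _ ≤ (Q' * (Q * M * Rᵀ)).rank := Matrix.rank_mul_le_left _ _
    _ ≤ (Q * M * Rᵀ).rank := Matrix.rank_mul_le_right _ _

omit [DecidableEq κ'] [DecidableEq μ'] in
/-- **`𝓜_r` is transported along padded legs**: if `P` is the matrix of a bijection of the slice
indices (`P'P = 1 = PP'`) and `Q, R` have left inverses, then `(P ⊗ Q ⊗ R)T ∈ 𝓜_r ↔ T ∈ 𝓜_r`
(rank of `Q (Tx) Rᵀ` is the rank of `Tx`; `x ↦ xP` is a bijection on nonzero forms).
[cite: BlaserIkenmeyerLysikovPandeySchreyer2019, Lemma 16 and Lemma 18] -/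
theorem actTensor_mem_minrankSet_iff {P : Matrix ι' ι F} {Q : Matrix κ' κ F} {R : Matrix μ' μ F}
    {P' : Matrix ι ι' F} {Q' : Matrix κ κ' F} {R' : Matrix μ μ' F} (hP : P' * P = 1)
    (hP2 : P * P' = 1) (hQ : Q' * Q = 1) (hR : R' * R = 1) (r : ℕ) (T : ι → κ → μ → F) :
    actTensor P Q R T ∈ (minrankSet F r : Set (ι' → κ' → μ' → F)) ↔
      T ∈ (minrankSet F r : Set (ι → κ → μ → F)) := by
  rw [mem_minrankSet_iff, mem_minrankSet_iff]
  constructor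
  · rintro ⟨y, hy, hr⟩
    rw [contract3_actTensor_rect, rank_mul_mul_transpose_eq hQ hR] at hr
    refine ⟨Matrix.vecMul y P, fun h0 => hy ?_, hr⟩
    have : y = Matrix.vecMul (Matrix.vecMul y P) P' := by
      rw [Matrix.vecMul_vecMul, hP2, Matrix.vecMul_one]
    rw [this, h0, Matrix.zero_vecMul]
  · rintro ⟨x, hx, hr⟩
    refine ⟨Matrix.vecMul x P', fun h0 => hx ?_, ?_⟩
    · have : x = Matrix.vecMul (Matrix.vecMul x P') P := by
        rw [Matrix.vecMul_vecMul, hP, Matrix.vecMul_one]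
      rw [this, h0, Matrix.zero_vecMul]
    · rwa [contract3_actTensor_rect, rank_mul_mul_transpose_eq hQ hR, Matrix.vecMul_vecMul, hP,
        Matrix.vecMul_one]

end MinrankTransport

/-! ### §4. Thm 19 over an arbitrary universe (re-assembly of t21's bricks) -/

section ThmNineteen

variable {F : Type u} [Field F]

/-- `𝓜_r` is closed (Thm 14) and invariant (Lemma 18): a tensor whose point lies in the orbit closure
of some `T₀ ∈ 𝓜_r` lies in `𝓜_r` — the universe-polymorphic form of the tree's
`BILPS2019Cor20.mem_minrankSet_of_mem_orbitClosure3` (x2's polymorphic Thm 14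
`BILPS2019Thm14.zariskiClosure_subset_image_minrankSet`).
[cite: BlaserIkenmeyerLysikovPandeySchreyer2019, Thm. 19 (proof, "⊇")] -/
theorem mem_minrankSet_of_mem_orbitClosure3 [IsAlgClosed F] {ι κ μ : Type*} [Fintype ι] [Fintype κ]
    [Fintype μ] [DecidableEq ι] [DecidableEq κ] [DecidableEq μ] {r : ℕ} {T₀ T : ι → κ → μ → F}
    (h₀ : T₀ ∈ (minrankSet F r : Set (ι → κ → μ → F))) (h : trilinearPt T ∈ orbitClosure3 T₀) :
    T ∈ (minrankSet F r : Set (ι → κ → μ → F)) := by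
  have hsub : trilinearPt '' glOrbit3 T₀ ⊆ trilinearPt '' (minrankSet F r : Set (ι → κ → μ → F)) := by
    rintro _ ⟨T', ⟨A, B, C, rfl⟩, rfl⟩
    exact ⟨_, actTensor_mem_minrankSet h₀ A B C, rfl⟩
  obtain ⟨T', hT', hTT'⟩ := BILPS2019Thm14.zariskiClosure_subset_image_minrankSet (F := F) hsub h
  rwa [← trilinearPt_injective hTT']

/-- **BILPS Thm 19 in typed membership form, any universe**: for `T ∈ U ⊗ L ⊗ L` whose `V`-legs lie in
an `n`-dimensional `V ≤ L`, `T ∈ 𝓜_r ↔ T ∈ \overline{GL·T_{k,n,r}}` (t21's construction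
`exists_actTensor_bilpsTensor_eq` + degeneration step, and Thm 14 + Lemma 18 backwards).
[cite: BlaserIkenmeyerLysikovPandeySchreyer2019, Thm. 19] -/
theorem mem_minrankSet_iff_mem_orbitClosure3_bilpsTensor [IsAlgClosed F] (k' n r : ℕ)
    (V : Submodule F (BIdx k' n r → F)) (hV : Module.finrank F V = n)
    (T : Option (Fin k') → BIdx k' n r → BIdx k' n r → F) (hTV : ∀ a c, (fun b => T a b c) ∈ V) :
    T ∈ (minrankSet F r : Set (Option (Fin k') → BIdx k' n r → BIdx k' n r → F)) ↔
      trilinearPt T ∈ orbitClosure3 (bilpsTensor F k' n r) := by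
  constructor
  · intro hT
    obtain ⟨A, B, C, h⟩ := BILPS2019Cor20.exists_actTensor_bilpsTensor_eq V hV T hTV hT
    rw [← h]
    exact BILPS2019Cor20.trilinearPt_actTensor_mem_orbitClosure3 _ A B C
  · exact mem_minrankSet_of_mem_orbitClosure3 (BILPS2019Cor20.bilpsTensor_mem_minrankSet F k' n r)

end ThmNineteen

/-! ### §5. The two cubes, and the case of at least two slices -/

section Cubes

variable (F : Type u) [Field F]

/-- **The first cube `t`**: the slices `T_0, …, T_{k-1} ∈ F^{n×n}` zero-padded into `F^{N×N×N}`
(slice `a < k`, rows and columns `< n`). [cite: BlaserIkenmeyerLysikovPandeySchreyer2019, Cor. 37 (proof, cubic format)] -/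
def padCube (N k n : ℕ) (T : Fin k → Fin n → Fin n → F) : Fin N → Fin N → Fin N → F :=
  fun a b c => if h : a.1 < k ∧ b.1 < n ∧ c.1 < n then T ⟨a.1, h.1⟩ ⟨b.1, h.2.1⟩ ⟨c.1, h.2.2⟩ else 0

/-- **The second cube `t'`**: `T_{k,n,r}` zero-padded into `F^{N×N×N}` — slice `0` is the unit
diagonal block `E_r` on the coordinates `[0, r)`, slice `a ∈ [1, k)` is the identity on the
coordinate block `[r + (a-1)n, r + an)`, everything else `0`.
[cite: BlaserIkenmeyerLysikovPandeySchreyer2019, §6.1 (definition of T_{k,n,r}) and Cor. 37] -/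
def tPrimeCube (N k n r : ℕ) : Fin N → Fin N → Fin N → F :=
  fun a b c => if b.1 = c.1 ∧ ((a.1 = 0 ∧ b.1 < r) ∨
    (1 ≤ a.1 ∧ a.1 < k ∧ r + a.1 * n ≤ b.1 + n ∧ b.1 < r + a.1 * n)) then 1 else 0

variable {F}

/-- The first cube is the zero-padding of `T` along the initial-segment embeddings.
[cite: BlaserIkenmeyerLysikovPandeySchreyer2019, Cor. 37 (proof, cubic format)] -/
theorem padCube_eq_actTensor {N k n : ℕ} (hk : k ≤ N) (hn : n ≤ N) (T : Fin k → Fin n → Fin n → F) :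
    padCube F N k n T = actTensor (embMatrix F (Fin.castLE hk)) (embMatrix F (Fin.castLE hn))
      (embMatrix F (Fin.castLE hn)) T := by
  funext a b c
  unfold padCube
  by_cases h : a.1 < k ∧ b.1 < n ∧ c.1 < n
  · rw [dif_pos h]
    have ha : Fin.castLE hk ⟨a.1, h.1⟩ = a := Fin.ext rfl
    have hb : Fin.castLE hn ⟨b.1, h.2.1⟩ = b := Fin.ext rfl
    have hc : Fin.castLE hn ⟨c.1, h.2.2⟩ = c := Fin.ext rfl
    have key := actTensor_embMatrix_apply_image (F := F) (Fin.castLE_injective hk)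
      (Fin.castLE_injective hn) (Fin.castLE_injective hn) T ⟨a.1, h.1⟩ ⟨b.1, h.2.1⟩ ⟨c.1, h.2.2⟩
    rw [ha, hb, hc] at key
    exact key.symm
  · rw [dif_neg h, actTensor_embMatrix_apply_eq_zero]
    simp only [not_and_or, not_lt] at h
    rcases h with h | h | h
    · exact Or.inl fun a' ha' => absurd (congrArg Fin.val ha') (by simp; omega)
    · exact Or.inr (Or.inl fun b' hb' => absurd (congrArg Fin.val hb') (by simp; omega))
    · exact Or.inr (Or.inr fun c' hc' => absurd (congrArg Fin.val hc') (by simp; omega))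

section TwoSlices

variable (k' n r : ℕ)

/-- The legs `F^n ↪ L = F^r ⊕ (F^n)^{k'}`: coordinate `i < r` to `e_{1 i}`, coordinate `i ≥ r` to
`e_{2, i-r}` (needs `k' ≥ 1`). [cite: BlaserIkenmeyerLysikovPandeySchreyer2019, Thm. 19 (V ≤ L)] -/
def legEmb (hk' : 0 < k') (i : Fin n) : BIdx k' n r :=
  if h : i.1 < r then Sum.inl ⟨i.1, h⟩ else Sum.inr (⟨i.1 - r, by omega⟩, ⟨0, hk'⟩)

/-- The slice index `Option (Fin k')` of `T_{k,n,r}` inside `Fin N`, `N = (k'+1)n + r`: `none ↦ 0`,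
`some i ↦ i + 1` (needs `n ≥ 1`). [cite: BlaserIkenmeyerLysikovPandeySchreyer2019, Cor. 37 (proof, cubic format)] -/
def cubeSlice (hn : 0 < n) : Option (Fin k') → Fin ((k' + 1) * n + r)
  | none => ⟨0, by nlinarith⟩
  | some i => ⟨i.1 + 1, by nlinarith [i.2]⟩

/-- The leg index `L = F^r ⊕ (F^n)^{k'}` inside `Fin N`: `e_{1 j} ↦ j`, `e_{i+2, j} ↦ r + i n + j`.
[cite: BlaserIkenmeyerLysikovPandeySchreyer2019, Cor. 37 (proof, cubic format)] -/
def cubeLeg : BIdx k' n r → Fin ((k' + 1) * n + r)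
  | Sum.inl j => ⟨j.1, by omega⟩
  | Sum.inr (j, i) => ⟨r + i.1 * n + j.1, by nlinarith [i.2, j.2]⟩

variable {k' n r}

/-- `legEmb` is injective (the `n` leg coordinates are distinct coordinates of `L`).
[cite: BlaserIkenmeyerLysikovPandeySchreyer2019, Thm. 19 (V ≤ L, dim V = n)] -/
theorem legEmb_injective (hk' : 0 < k') : Function.Injective (legEmb k' n r hk') := by
  intro i i' h
  apply Fin.ext
  unfold legEmb at h
  by_cases hi : i.1 < r <;> by_cases hi' : i'.1 < r
  · rw [dif_pos hi, dif_pos hi'] at h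
    exact Fin.mk.inj (Sum.inl_injective h)
  · rw [dif_pos hi, dif_neg hi'] at h; exact absurd h Sum.inl_ne_inr
  · rw [dif_neg hi, dif_pos hi'] at h; exact absurd h Sum.inr_ne_inl
  · rw [dif_neg hi, dif_neg hi'] at h
    have h1 := congrArg Fin.val (congrArg Prod.fst (Sum.inr_injective h))
    simp only at h1
    omega

/-- `cubeSlice` is injective. [cite: BlaserIkenmeyerLysikovPandeySchreyer2019, Cor. 37 (proof, cubic format)] -/
theorem cubeSlice_injective (hn : 0 < n) : Function.Injective (cubeSlice k' n r hn) := by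
  rintro (_ | i) (_ | i') h
  · rfl
  · exact absurd (congrArg Fin.val h) (by simp [cubeSlice])
  · exact absurd (congrArg Fin.val h) (by simp [cubeSlice])
  · have h1 := congrArg Fin.val h
    simp only [cubeSlice, add_left_inj] at h1
    rw [Fin.ext h1]

/-- No coordinate of a later block lies in the first block. [folklore] -/
private theorem not_block_lt (r t j : ℕ) : ¬ r + t + j < r := by omega

/-- `cubeLeg` is injective (the blocks `[0,r)`, `[r + i n, r + (i+1) n)` of `[0, N)` are disjoint).
[cite: BlaserIkenmeyerLysikovPandeySchreyer2019, Cor. 37 (proof, cubic format)] -/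
theorem cubeLeg_injective : Function.Injective (cubeLeg k' n r) := by
  rintro (j | ⟨j, i⟩) (j' | ⟨j', i'⟩) h <;> have h1 := congrArg Fin.val h <;> simp only [cubeLeg] at h1
  · rw [Fin.ext h1]
  · exact absurd (h1 ▸ j.2) (not_block_lt _ _ _)
  · exact absurd (h1.symm ▸ j'.2) (not_block_lt _ _ _)
  · have hj := j.2; have hj' := j'.2
    have key : i.1 = i'.1 := by
      by_contra hne
      rcases Nat.lt_or_gt_of_ne hne with hlt | hlt
      · have : (i.1 + 1) * n ≤ i'.1 * n := Nat.mul_le_mul_right _ hlt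
        nlinarith
      · have : (i'.1 + 1) * n ≤ i.1 * n := Nat.mul_le_mul_right _ hlt
        nlinarith
    rw [key] at h1
    rw [Fin.ext key, Fin.ext (show j.1 = j'.1 by omega)]

/-- Slices: `cubeSlice ∘ finSuccEquiv` is the initial-segment embedding `Fin (k'+1) ↪ Fin N`.
[cite: BlaserIkenmeyerLysikovPandeySchreyer2019, Cor. 37 (proof, cubic format)] -/
theorem cubeSlice_comp_finSuccEquiv (hn : 0 < n) (hk : k' + 1 ≤ (k' + 1) * n + r) :
    cubeSlice k' n r hn ∘ finSuccEquiv k' = Fin.castLE hk := by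
  funext a
  refine Fin.cases ?_ (fun i => ?_) a
  · apply Fin.ext; simp [cubeSlice, finSuccEquiv_zero]
  · apply Fin.ext; simp [cubeSlice, finSuccEquiv_succ]

/-- Legs: `cubeLeg ∘ legEmb` is the initial-segment embedding `Fin n ↪ Fin N`.
[cite: BlaserIkenmeyerLysikovPandeySchreyer2019, Cor. 37 (proof, cubic format)] -/
theorem cubeLeg_comp_legEmb (hk' : 0 < k') (hnN : n ≤ (k' + 1) * n + r) :
    cubeLeg k' n r ∘ legEmb k' n r hk' = Fin.castLE hnN := by
  funext i
  simp only [Function.comp_apply, legEmb]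
  by_cases h : i.1 < r
  · rw [dif_pos h]; rfl
  · rw [dif_neg h]
    apply Fin.ext
    simp [cubeLeg]
    omega

/-- The `n`-dimensional subspace `V ≤ L` spanned by the image coordinates of `legEmb`.
[cite: BlaserIkenmeyerLysikovPandeySchreyer2019, Thm. 19 (V ≤ L)] -/
def legSpan (hk' : 0 < k') : Submodule F (BIdx k' n r → F) :=
  Submodule.span F (Set.range fun i : Fin n => Pi.single (legEmb k' n r hk' i) (1 : F))

/-- `dim V = n` for the leg subspace `V = legSpan`. [cite: BlaserIkenmeyerLysikovPandeySchreyer2019, Thm. 19 (dim V = n)] -/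
theorem finrank_legSpan (hk' : 0 < k') : Module.finrank F (legSpan (F := F) (n := n) (r := r) hk') = n := by
  have hli : LinearIndependent F (fun i : Fin n => Pi.single (M := fun _ => F) (legEmb k' n r hk' i) (1 : F)) := by
    have h0 : LinearIndependent F (fun b : BIdx k' n r => Pi.single (M := fun _ => F) b (1 : F)) := by
      convert (Pi.basisFun F (BIdx k' n r)).linearIndependent using 1
      funext b
      exact (Pi.basisFun_apply F (BIdx k' n r) b).symm
    exact h0.comp _ (legEmb_injective hk')
  rw [legSpan, finrank_span_eq_card hli, Fintype.card_fin]

/-- The `V`-legs of a tensor padded along `legEmb` lie in `V`. [cite: BlaserIkenmeyerLysikovPandeySchreyer2019, Thm. 19 (V ≤ L)] -/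
theorem legs_mem_legSpan (hk' : 0 < k') (P : Matrix (Option (Fin k')) (Fin (k' + 1)) F)
    (T : Fin (k' + 1) → Fin n → Fin n → F) (a : Option (Fin k')) (c : BIdx k' n r) :
    (fun b => actTensor P (embMatrix F (legEmb k' n r hk')) (embMatrix F (legEmb k' n r hk')) T a b c) ∈
      legSpan (F := F) (n := n) (r := r) hk' := by
  have hfun : (fun b => actTensor P (embMatrix F (legEmb k' n r hk')) (embMatrix F (legEmb k' n r hk')) T a b c) =
      ∑ b₀ : Fin n, (∑ a₀, ∑ c₀, P a a₀ * embMatrix F (legEmb k' n r hk') c c₀ * T a₀ b₀ c₀) •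
        Pi.single (M := fun _ => F) (legEmb k' n r hk' b₀) (1 : F) := by
    funext b
    simp only [actTensor_apply, Finset.sum_apply, Pi.smul_apply, smul_eq_mul]
    rw [Finset.sum_comm]
    refine Finset.sum_congr rfl fun b₀ _ => ?_
    rw [Finset.sum_mul]
    refine Finset.sum_congr rfl fun a₀ _ => ?_
    rw [Finset.sum_mul]
    refine Finset.sum_congr rfl fun c₀ _ => ?_
    by_cases hb : legEmb k' n r hk' b₀ = b
    · rw [hb, Pi.single_eq_same, embMatrix_apply, if_pos hb]; ring
    · rw [Pi.single_eq_of_ne (Ne.symm hb), embMatrix_apply, if_neg hb]; ring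
  rw [hfun]
  exact Submodule.sum_mem _ fun b₀ _ => Submodule.smul_mem _ _ (Submodule.subset_span ⟨b₀, rfl⟩)

/-- Arithmetic of the coordinate blocks: `r + i n + j = r + i' n + j'` with `j, j' < n` forces
`i = i'` and `j = j'`. [folklore] -/
private theorem block_eq_iff {i i' j j' : ℕ} (hj : j < n) (hj' : j' < n) :
    r + i * n + j = r + i' * n + j' ↔ i = i' ∧ j = j' := by
  constructor
  · intro h
    have key : i = i' := by
      by_contra hne
      rcases Nat.lt_or_gt_of_ne hne with hlt | hlt
      · have : (i + 1) * n ≤ i' * n := Nat.mul_le_mul_right _ hlt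
        nlinarith
      · have : (i' + 1) * n ≤ i * n := Nat.mul_le_mul_right _ hlt
        nlinarith
    subst key
    exact ⟨rfl, by omega⟩
  · rintro ⟨rfl, rfl⟩; rfl

/-- Arithmetic of the coordinate blocks: `r + (i+1) n ≤ r + i₁ n + j + n` and
`r + i₁ n + j < r + (i+1) n` (`j < n`) together say `i₁ = i`. [folklore] -/
private theorem block_mem_iff {i i₁ j : ℕ} (hj : j < n) :
    (r + (i + 1) * n ≤ r + i₁ * n + j + n ∧ r + i₁ * n + j < r + (i + 1) * n) ↔ i₁ = i := by
  constructor
  · rintro ⟨h1, h2⟩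
    by_contra hne
    rcases Nat.lt_or_gt_of_ne hne with hlt | hlt
    · have : (i₁ + 1) * n ≤ i * n := Nat.mul_le_mul_right _ hlt
      nlinarith
    · have : (i + 1) * n ≤ i₁ * n := Nat.mul_le_mul_right _ hlt
      nlinarith
  · rintro rfl
    constructor <;> nlinarith

/-- **The second cube is the zero-padding of `T_{k,n,r}`** along `cubeSlice`, `cubeLeg`.
[cite: BlaserIkenmeyerLysikovPandeySchreyer2019, §6.1 (definition of T_{k,n,r}) and Cor. 37] -/
theorem tPrimeCube_eq_actTensor (hn : 0 < n) :
    tPrimeCube F ((k' + 1) * n + r) (k' + 1) n r =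
      actTensor (embMatrix F (cubeSlice k' n r hn)) (embMatrix F (cubeLeg k' n r))
        (embMatrix F (cubeLeg k' n r)) (bilpsTensor F k' n r) := by
  funext a b c
  -- preimages of the three coordinates, when they exist
  have hsl : ∀ {a : Fin ((k' + 1) * n + r)}, a.1 < k' + 1 → ∃ α, cubeSlice k' n r hn α = a := by
    intro a ha
    by_cases h0 : a.1 = 0
    · exact ⟨none, Fin.ext (by simp [cubeSlice, h0])⟩
    · exact ⟨some ⟨a.1 - 1, by omega⟩, Fin.ext (by simp [cubeSlice]; omega)⟩
  have hlg : ∀ {b : Fin ((k' + 1) * n + r)}, b.1 < r + k' * n → ∃ β, cubeLeg k' n r β = b := by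
    intro b hb
    by_cases hbr : b.1 < r
    · exact ⟨Sum.inl ⟨b.1, hbr⟩, Fin.ext rfl⟩
    · have hq : (b.1 - r) / n < k' := by
        rw [Nat.div_lt_iff_lt_mul hn]; omega
      refine ⟨Sum.inr (⟨(b.1 - r) % n, Nat.mod_lt _ hn⟩, ⟨(b.1 - r) / n, hq⟩), Fin.ext ?_⟩
      simp only [cubeLeg]
      have := Nat.div_add_mod (b.1 - r) n
      rw [Nat.mul_comm] at this
      omega
  by_cases ha : a.1 < k' + 1
  swap
  · -- slice index off the image
    rw [actTensor_embMatrix_apply_eq_zero _ _ _ _ (Or.inl fun α hα => ?_)]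
    · unfold tPrimeCube
      rw [if_neg]
      rintro ⟨-, ⟨h0, -⟩ | ⟨-, hlt, -⟩⟩ <;> omega
    · rcases α with _ | i
      · simp [cubeSlice, Fin.ext_iff] at hα; omega
      · simp [cubeSlice, Fin.ext_iff] at hα; omega
  by_cases hb : b.1 < r + k' * n
  swap
  · rw [actTensor_embMatrix_apply_eq_zero _ _ _ _ (Or.inr (Or.inl fun β hβ => ?_))]
    · unfold tPrimeCube
      rw [if_neg]
      rintro ⟨-, ⟨-, hlt⟩ | ⟨-, hak, -, hlt⟩⟩
      · omega
      · have : a.1 * n ≤ k' * n := Nat.mul_le_mul_right _ (by omega)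
        omega
    · rcases β with j | ⟨j, i⟩
      · simp [cubeLeg, Fin.ext_iff] at hβ; omega
      · simp [cubeLeg, Fin.ext_iff] at hβ
        have : (i.1 + 1) * n ≤ k' * n := Nat.mul_le_mul_right _ i.2
        have := j.2
        nlinarith
  by_cases hc : c.1 < r + k' * n
  swap
  · rw [actTensor_embMatrix_apply_eq_zero _ _ _ _ (Or.inr (Or.inr fun γ hγ => ?_))]
    · unfold tPrimeCube
      rw [if_neg]
      rintro ⟨hbc, ⟨-, hlt⟩ | ⟨-, hak, -, hlt⟩⟩
      · omega
      · have : a.1 * n ≤ k' * n := Nat.mul_le_mul_right _ (by omega)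
        omega
    · rcases γ with j | ⟨j, i⟩
      · simp [cubeLeg, Fin.ext_iff] at hγ; omega
      · simp [cubeLeg, Fin.ext_iff] at hγ
        have : (i.1 + 1) * n ≤ k' * n := Nat.mul_le_mul_right _ i.2
        have := j.2
        nlinarith
  -- all three coordinates are images
  obtain ⟨α, rfl⟩ := hsl ha
  obtain ⟨β, rfl⟩ := hlg hb
  obtain ⟨γ, rfl⟩ := hlg hc
  rw [actTensor_embMatrix_apply_image (cubeSlice_injective hn) cubeLeg_injective cubeLeg_injective]
  unfold tPrimeCube
  rcases α with _ | i <;> rcases β with j | ⟨j, i₁⟩ <;> rcases γ with j' | ⟨j', i₂⟩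
  · -- none / inl / inl
    rw [BILPS2019Cor20.bilpsTensor_none_inl_inl]
    simp only [cubeSlice, cubeLeg, Fin.val_inj]
    by_cases hjj : j = j'
    · subst hjj; simp
    · simp [hjj]
  · -- none / inl / inr
    rw [BILPS2019Cor20.bilpsTensor_none_inl_inr, if_neg]
    simp only [cubeSlice, cubeLeg]
    rintro ⟨h, -⟩
    exact not_block_lt _ _ _ (h ▸ j.2)
  · -- none / inr / inl
    rw [BILPS2019Cor20.bilpsTensor_none_inr, if_neg]
    simp only [cubeSlice, cubeLeg]
    rintro ⟨h, -⟩
    exact not_block_lt _ _ _ (h.symm ▸ j'.2)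
  · -- none / inr / inr
    rw [BILPS2019Cor20.bilpsTensor_none_inr, if_neg]
    simp only [cubeSlice, cubeLeg]
    rintro ⟨-, ⟨-, hlt⟩ | ⟨h10, -⟩⟩
    · exact not_block_lt _ _ _ hlt
    · omega
  · -- some / inl / inl
    rw [BILPS2019Cor20.bilpsTensor_some_inl, if_neg]
    simp only [cubeSlice, cubeLeg]
    have hj := j.2
    have hn1 : n ≤ (i.1 + 1) * n := Nat.le_mul_of_pos_left n (Nat.succ_pos _)
    rintro ⟨-, ⟨h0, -⟩ | ⟨-, -, h1, -⟩⟩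
    · omega
    · generalize (i.1 + 1) * n = t at h1 hn1
      omega
  · -- some / inl / inr
    rw [BILPS2019Cor20.bilpsTensor_some_inl, if_neg]
    simp only [cubeSlice, cubeLeg]
    rintro ⟨h, -⟩
    exact not_block_lt _ _ _ (h ▸ j.2)
  · -- some / inr / inl
    rw [BILPS2019Cor20.bilpsTensor_some_inr_inl, if_neg]
    simp only [cubeSlice, cubeLeg]
    rintro ⟨h, -⟩
    exact not_block_lt _ _ _ (h.symm ▸ j'.2)
  · -- some / inr / inr
    rw [BILPS2019Cor20.bilpsTensor_some_inr_inr]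
    have h1k : 1 ≤ i.1 + 1 ∧ i.1 + 1 < k' + 1 := ⟨Nat.succ_pos _, Nat.succ_lt_succ i.2⟩
    simp only [cubeSlice, cubeLeg, block_eq_iff j.2 j'.2, block_mem_iff j.2, h1k, true_and,
      Fin.val_inj]
    by_cases h1 : i₁ = i <;> by_cases h2 : i₂ = i <;> by_cases h3 : j = j'
    · subst h1; subst h2; subst h3; simp
    · subst h1; subst h2; simp [h3]
    · subst h1; simp [h2, Ne.symm h2]
    · subst h1; simp [h2, Ne.symm h2, h3]
    · subst h2; simp [h1]
    · subst h2; simp [h1]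
    · simp [h1, h2]
    · simp [h1, h2]

/-- **At least two slices** (`k = k'+1`, `k' ≥ 1`, `n ≥ 1`): `T ∈ 𝓜_r` iff the point of the
first cube lies in the orbit closure of the second — Thm 19 for the tensor `T` moved into the format
`U ⊗ L ⊗ L` along (`finSuccEquiv`, `legEmb`, `legEmb`), then zero-padding of all three legs into
`F^N`. [cite: BlaserIkenmeyerLysikovPandeySchreyer2019, Cor. 37 (proof) with Thm. 19] -/
theorem mem_minrankSet_iff_padCube_of_two_le [IsAlgClosed F] (hk' : 0 < k') (hn : 0 < n)
    (T : Fin (k' + 1) → Fin n → Fin n → F) :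
    T ∈ (minrankSet F r : Set (Fin (k' + 1) → Fin n → Fin n → F)) ↔
      trilinearPt (padCube F ((k' + 1) * n + r) (k' + 1) n T) ∈
        orbitClosure3 (tPrimeCube F ((k' + 1) * n + r) (k' + 1) n r) := by
  have hkN : k' + 1 ≤ (k' + 1) * n + r := by nlinarith
  have hnN : n ≤ (k' + 1) * n + r := by nlinarith
  -- step 1: move `T` into the format `U ⊗ L ⊗ L`
  have hPinv : embMatrix F (finSuccEquiv k').symm * embMatrix F (finSuccEquiv k') = 1 :=
    embMatrix_symm_mul_embMatrix _
  have hPinv' : embMatrix F (finSuccEquiv k') * embMatrix F (finSuccEquiv k').symm = 1 := by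
    have := embMatrix_symm_mul_embMatrix (F := F) (finSuccEquiv k').symm
    rwa [Equiv.symm_symm] at this
  have hQinv : (embMatrix F (legEmb k' n r hk'))ᵀ * embMatrix F (legEmb k' n r hk') = 1 :=
    embMatrix_transpose_mul_self (legEmb_injective hk')
  rw [← actTensor_mem_minrankSet_iff hPinv hPinv' hQinv hQinv r T]
  -- step 2: Thm 19
  rw [mem_minrankSet_iff_mem_orbitClosure3_bilpsTensor k' n r (legSpan hk') (finrank_legSpan hk') _
    (fun a c => legs_mem_legSpan hk' _ T a c)]
  -- step 3: zero-pad into the cube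
  have hSinv : (embMatrix F (cubeSlice k' n r hn))ᵀ * embMatrix F (cubeSlice k' n r hn) = 1 :=
    embMatrix_transpose_mul_self (cubeSlice_injective hn)
  have hLinv : (embMatrix F (cubeLeg k' n r))ᵀ * embMatrix F (cubeLeg k' n r) = 1 :=
    embMatrix_transpose_mul_self cubeLeg_injective
  rw [← trilinearPt_actTensor_mem_orbitClosure3_iff hSinv hLinv hLinv, ← tPrimeCube_eq_actTensor hn,
    actTensor_actTensor, embMatrix_mul_embMatrix, embMatrix_mul_embMatrix,
    cubeSlice_comp_finSuccEquiv hn hkN, cubeLeg_comp_legEmb hk' hnN, ← padCube_eq_actTensor hkN hnN]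

end TwoSlices

/-! #### One slice (`k = 1`): `{A : rk A ≤ r}` is the orbit closure of `E_r` -/

section OneSlice

variable {N : ℕ}

/-- The one-slice tensor `e_0 ⊗ E Eᵀ` (`E` the padding matrix of `f : [r] ↪ [N]`): the unit
diagonal on the image of `f`. [cite: BlaserIkenmeyerLysikovPandeySchreyer2019, §6.1 (T_{1,n,r} = e_1 ⊗ ∑_{j ≤ r} e_{1j} ⊗ e_{1j})] -/
def oneSliceE {r : ℕ} (f : Fin r → Fin N) : Fin 1 → Fin N → Fin N → F :=
  fun _ b c => (embMatrix F f * (embMatrix F f)ᵀ) b c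

/-- The contraction of a one-slice tensor is a multiple of its slice. [cite: BlaserIkenmeyerLysikovPandeySchreyer2019, §5 (before Def. 13)] -/
theorem contract3_fin_one (S : Fin 1 → Fin N → Fin N → F) (x : Fin 1 → F) :
    contract3 S x = x 0 • Matrix.of (S 0) := by
  ext b c
  simp [contract3_apply]

/-- A one-slice degeneration: `(1 ⊗ B ⊗ C)(e_0 ⊗ D) = e_0 ⊗ B D Cᵀ`. [cite: BlaserIkenmeyerLysikovPandeySchreyer2019, Lemma 18 (proof)] -/
theorem actTensor_one_slice (B C D : Matrix (Fin N) (Fin N) F) :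
    actTensor (1 : Matrix (Fin 1) (Fin 1) F) B C (fun _ b c => D b c) =
      fun _ b c => (B * D * Cᵀ) b c := by
  funext a b c
  rw [actTensor_apply, Fin.sum_univ_one, Subsingleton.elim a 0]
  simp only [Matrix.one_apply_eq, one_mul, Matrix.mul_apply, Matrix.transpose_apply, Finset.sum_mul]
  rw [Finset.sum_comm]
  exact Finset.sum_congr rfl fun _ _ => Finset.sum_congr rfl fun _ _ => by ring

/-- **One slice: `S ∈ 𝓜_r ↔ S ∈ \overline{GL·(e_0 ⊗ E_r)}`** for `S ∈ F^1 ⊗ F^N ⊗ F^N` and any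
injective `f : [r] ↪ [N]` (the case `k = 1` of "minrank varieties are orbit closures", where
Thm 19 as printed needs `n ≤ r`): rank factorisation `A = U V = (U Eᵀ) (E Eᵀ) (E V)`, an
`End³`-degeneration, and backwards Thm 14 + Lemma 18.
[cite: BlaserIkenmeyerLysikovPandeySchreyer2019, Cor. 37 (proof: "minrank varieties can be written as orbit closures"), k = 1] -/
theorem oneSlice_mem_minrankSet_iff [IsAlgClosed F] {r : ℕ} {f : Fin r → Fin N}
    (hf : Function.Injective f) (S : Fin 1 → Fin N → Fin N → F) :
    S ∈ (minrankSet F r : Set (Fin 1 → Fin N → Fin N → F)) ↔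
      trilinearPt S ∈ orbitClosure3 (oneSliceE (F := F) f) := by
  have hE : (embMatrix F f)ᵀ * embMatrix F f = 1 := embMatrix_transpose_mul_self hf
  constructor
  · rintro ⟨x, hx, hr⟩
    have hx0 : x 0 ≠ 0 := fun h0 => hx (funext fun i => by rw [Subsingleton.elim i 0, h0]; rfl)
    rw [contract3_fin_one] at hr
    have hrk : (Matrix.of (S 0)).rank ≤ r := by
      have h1 : ((x 0)⁻¹ • (1 : Matrix (Fin N) (Fin N) F)) * (x 0 • Matrix.of (S 0)) = Matrix.of (S 0) := by
        rw [Matrix.smul_mul, Matrix.one_mul, smul_smul, inv_mul_cancel₀ hx0, one_smul]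
      calc (Matrix.of (S 0)).rank = (((x 0)⁻¹ • (1 : Matrix (Fin N) (Fin N) F)) * (x 0 • Matrix.of (S 0))).rank := by
            rw [h1]
        _ ≤ (x 0 • Matrix.of (S 0)).rank := Matrix.rank_mul_le_right _ _
        _ ≤ r := hr
    obtain ⟨U, V, hUV⟩ := KumarVolk2020.exists_mul_eq_of_rank_le (Matrix.of (S 0)) hrk
    have hS : S = actTensor (1 : Matrix (Fin 1) (Fin 1) F) (U * (embMatrix F f)ᵀ) (Vᵀ * (embMatrix F f)ᵀ)
        (oneSliceE f) := by
      unfold oneSliceE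
      rw [actTensor_one_slice]
      have hprod : U * (embMatrix F f)ᵀ * (embMatrix F f * (embMatrix F f)ᵀ) * (Vᵀ * (embMatrix F f)ᵀ)ᵀ =
          Matrix.of (S 0) := by
        rw [Matrix.transpose_mul, Matrix.transpose_transpose, Matrix.transpose_transpose]
        simp only [Matrix.mul_assoc]
        rw [← Matrix.mul_assoc (embMatrix F f)ᵀ (embMatrix F f), hE, Matrix.one_mul,
          ← Matrix.mul_assoc (embMatrix F f)ᵀ (embMatrix F f), hE, Matrix.one_mul, hUV]
      rw [hprod]
      funext a b c
      rw [Subsingleton.elim a 0]; rfl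
    rw [hS]
    exact BILPS2019Cor20.trilinearPt_actTensor_mem_orbitClosure3_of_end _ _ _ _
  · refine mem_minrankSet_of_mem_orbitClosure3 ⟨fun _ => 1, fun h => one_ne_zero (congr_fun h 0), ?_⟩
    rw [contract3_fin_one, one_smul]
    change (embMatrix F f * (embMatrix F f)ᵀ).rank ≤ r
    exact (Matrix.rank_mul_le_left _ _).trans ((Matrix.rank_le_card_width _).trans (by simp))

/-- Entries of `E Eᵀ` for the initial-segment embedding `[r] ↪ [N]`: the unit diagonal on `[0, r)`.
[folklore] -/
private theorem embMatrix_mul_transpose_apply_castLE {r : ℕ} (hrN : r ≤ N) (b c : Fin N) :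
    (embMatrix F (Fin.castLE hrN) * (embMatrix F (Fin.castLE hrN))ᵀ) b c =
      if b.1 = c.1 ∧ b.1 < r then 1 else 0 := by
  rw [Matrix.mul_apply]
  by_cases hb : b.1 < r
  · rw [Finset.sum_eq_single ⟨b.1, hb⟩]
    · have h1 : Fin.castLE hrN ⟨b.1, hb⟩ = b := Fin.ext rfl
      rw [Matrix.transpose_apply, embMatrix_apply, embMatrix_apply, if_pos h1, one_mul]
      by_cases hbc : b.1 = c.1
      · rw [if_pos (show Fin.castLE hrN ⟨b.1, hb⟩ = c from Fin.ext hbc), if_pos ⟨hbc, hb⟩]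
      · rw [if_neg (show ¬ Fin.castLE hrN ⟨b.1, hb⟩ = c from fun h => hbc (congrArg Fin.val h)),
          if_neg fun h => hbc h.1]
    · intro j _ hj
      rw [embMatrix_apply, if_neg, zero_mul]
      exact fun h => hj (Fin.ext (show j.1 = b.1 from congrArg Fin.val h))
    · intro h; exact absurd (Finset.mem_univ _) h
  · rw [if_neg fun h => hb h.2]
    refine Finset.sum_eq_zero fun j _ => ?_
    rw [embMatrix_apply, if_neg, zero_mul]
    exact fun h => hb (by rw [← h]; exact j.2)

/-- The second cube for `k = 1` is the zero-padding of `e_0 ⊗ E_r`. [cite: BlaserIkenmeyerLysikovPandeySchreyer2019, Cor. 37 (proof), k = 1] -/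
theorem tPrimeCube_one_eq_actTensor {n r : ℕ} (h1N : 1 ≤ 1 * n + r) (hrN : r ≤ 1 * n + r) :
    tPrimeCube F (1 * n + r) 1 n r =
      actTensor (embMatrix F (Fin.castLE h1N)) (1 : Matrix (Fin (1 * n + r)) (Fin (1 * n + r)) F) 1
        (oneSliceE (Fin.castLE hrN)) := by
  funext a b c
  rw [actTensor_apply, Fin.sum_univ_one, Finset.sum_eq_single b, Finset.sum_eq_single c]
  · unfold oneSliceE tPrimeCube
    rw [embMatrix_mul_transpose_apply_castLE, Matrix.one_apply_eq, Matrix.one_apply_eq, embMatrix_apply,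
      mul_one, mul_one]
    have hiff : (b.1 = c.1 ∧ ((a.1 = 0 ∧ b.1 < r) ∨
        (1 ≤ a.1 ∧ a.1 < 1 ∧ r + a.1 * n ≤ b.1 + n ∧ b.1 < r + a.1 * n))) ↔
        (a.1 = 0 ∧ (b.1 = c.1 ∧ b.1 < r)) := by
      constructor
      · rintro ⟨h1, ⟨h2, h3⟩ | ⟨h4, h5, -⟩⟩
        · exact ⟨h2, h1, h3⟩
        · omega
      · rintro ⟨h1, h2, h3⟩
        exact ⟨h2, Or.inl ⟨h1, h3⟩⟩
    have ha : (Fin.castLE h1N 0 = a) ↔ a.1 = 0 :=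
      ⟨fun h => by rw [← h]; rfl, fun h => Fin.ext (by rw [Fin.val_castLE]; exact h.symm)⟩
    simp only [hiff, ha]
    by_cases h1 : a.1 = 0 <;> by_cases h2 : b.1 = c.1 ∧ b.1 < r <;> simp [h1, h2]
  · intro c' _ hc'; rw [Matrix.one_apply_ne (Ne.symm hc')]; ring
  · intro h; exact absurd (Finset.mem_univ _) h
  · intro b' _ hb'; rw [Matrix.one_apply_ne (Ne.symm hb')]; simp
  · intro h; exact absurd (Finset.mem_univ _) h

/-- **One slice** (`k = 1`, `n ≥ 1`): `T ∈ 𝓜_r` iff the point of the first cube lies in the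
orbit closure of the second. [cite: BlaserIkenmeyerLysikovPandeySchreyer2019, Cor. 37 (proof), k = 1] -/
theorem mem_minrankSet_iff_padCube_of_one [IsAlgClosed F] {n : ℕ} (hn : 0 < n) (r : ℕ)
    (T : Fin 1 → Fin n → Fin n → F) :
    T ∈ (minrankSet F r : Set (Fin 1 → Fin n → Fin n → F)) ↔
      trilinearPt (padCube F (1 * n + r) 1 n T) ∈ orbitClosure3 (tPrimeCube F (1 * n + r) 1 n r) := by
  have h1N : 1 ≤ 1 * n + r := by omega
  have hnN : n ≤ 1 * n + r := by omega
  have hrN : r ≤ 1 * n + r := by omega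
  have h11 : (1 : Matrix (Fin 1) (Fin 1) F) * 1 = 1 := Matrix.mul_one _
  have hNN : (1 : Matrix (Fin (1 * n + r)) (Fin (1 * n + r)) F) * 1 = 1 := Matrix.mul_one _
  have hE : (embMatrix F (Fin.castLE hnN))ᵀ * embMatrix F (Fin.castLE hnN) = 1 :=
    embMatrix_transpose_mul_self (Fin.castLE_injective hnN)
  have hE₁ : (embMatrix F (Fin.castLE h1N))ᵀ * embMatrix F (Fin.castLE h1N) = 1 :=
    embMatrix_transpose_mul_self (Fin.castLE_injective h1N)
  rw [← actTensor_mem_minrankSet_iff h11 h11 hE hE r T,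
    oneSlice_mem_minrankSet_iff (Fin.castLE_injective hrN),
    ← trilinearPt_actTensor_mem_orbitClosure3_iff hE₁ hNN hNN, ← tPrimeCube_one_eq_actTensor h1N hrN,
    actTensor_actTensor, Matrix.mul_one, Matrix.one_mul, ← padCube_eq_actTensor h1N hnN]

end OneSlice

/-! #### All cases -/

/-- **The minrank variety as an orbit closure, cubic format** (any number `k ≥ 1` of slices, any
`n`, any `r`; `N = k n + r`): `T ∈ 𝓜_r ⊆ F^k ⊗ F^n ⊗ F^n` iff the zero-padded cube of `T` lies in
the `GL_N³`-orbit closure of the zero-padded `T_{k,n,r}`.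
[cite: BlaserIkenmeyerLysikovPandeySchreyer2019, Cor. 37 (proof: "minrank varieties can be written as orbit closures")] -/
theorem mem_minrankSet_iff_padCube [IsAlgClosed F] {k n : ℕ} (hk : 0 < k) (r : ℕ)
    (T : Fin k → Fin n → Fin n → F) :
    T ∈ (minrankSet F r : Set (Fin k → Fin n → Fin n → F)) ↔
      trilinearPt (padCube F (k * n + r) k n T) ∈ orbitClosure3 (tPrimeCube F (k * n + r) k n r) := by
  obtain ⟨k', rfl⟩ : ∃ k', k = k' + 1 := ⟨k - 1, by omega⟩
  rcases Nat.eq_zero_or_pos n with rfl | hn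
  · -- no rows: both sides hold
    refine iff_of_true ⟨fun _ => 1, fun h => one_ne_zero (congr_fun h 0), ?_⟩ ?_
    · exact (Matrix.rank_le_card_width _).trans (by simp)
    · have h0 : padCube F ((k' + 1) * 0 + r) (k' + 1) 0 T =
          actTensor (0 : Matrix _ _ F) (0 : Matrix _ _ F) (0 : Matrix _ _ F)
            (tPrimeCube F ((k' + 1) * 0 + r) (k' + 1) 0 r) := by
        funext a b c
        simp [padCube, actTensor_apply]
      rw [h0]
      exact BILPS2019Cor20.trilinearPt_actTensor_mem_orbitClosure3_of_end _ _ _ _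
  rcases Nat.eq_zero_or_pos k' with rfl | hk'
  · exact mem_minrankSet_iff_padCube_of_one hn r T
  · exact mem_minrankSet_iff_padCube_of_two_le hk' hn T

/-- The same with CONTAINMENT of orbit closures (the form of the orbit closure containment problem).
[cite: BlaserIkenmeyerLysikovPandeySchreyer2019, Cor. 37 (proof)] -/
theorem mem_minrankSet_iff_orbitClosure3_padCube_subset [IsAlgClosed F] {k n : ℕ} (hk : 0 < k) (r : ℕ)
    (T : Fin k → Fin n → Fin n → F) :
    T ∈ (minrankSet F r : Set (Fin k → Fin n → Fin n → F)) ↔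
      orbitClosure3 (padCube F (k * n + r) k n T) ⊆ orbitClosure3 (tPrimeCube F (k * n + r) k n r) := by
  rw [orbitClosure3_subset_iff, mem_minrankSet_iff_padCube hk]

end Cubes

/-! ### §7. The instance map `HMinRank1 → OCC` and its correctness -/

section Reduction

variable (F : Type u) [Field F]

/-- The set of yes-instances `(N, t, t')` of the orbit closure containment problem read in `F` (the
set whose code language is `occLanguage F`). [cite: BlaserIkenmeyerLysikovPandeySchreyer2019, Cor. 37] -/
def occSet : Set (ℕ × List ℤ × List ℤ) :=
  {y | y.2.1.length = y.1 ^ 3 ∧ y.2.2.length = y.1 ^ 3 ∧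
    orbitClosure3 (cubeOfList F y.1 y.2.1) ⊆ orbitClosure3 (cubeOfList F y.1 y.2.2)}

/-- `occLanguage` is the code language of `occSet`. [cite: BlaserIkenmeyerLysikovPandeySchreyer2019, Cor. 37] -/
theorem occLanguage_eq : occLanguage F = occInstEncoding.toLanguage (occSet F) := rfl

variable {F}

/-- **Entry of the first cube at the flat position `p < N³`** (`(a, b, c) = (p / N², p / N mod N,
p mod N)`): `A_a[b, c]` if `a < k`, `b, c < n`, else `0`. [cite: BlaserIkenmeyerLysikovPandeySchreyer2019, Cor. 37 (proof, cubic format)] -/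
def tEntryO (n k : ℕ) (l : List ℤ) (N p : ℕ) : ℤ :=
  if p / N ^ 2 < k ∧ p / N % N < n ∧ p % N < n then
    l.getD (p / N ^ 2 * n ^ 2 + p / N % N * n + p % N) 0 else 0

/-- **Entry of the second cube at the flat position `p < N³`** (the padded `T_{k,n,r}`).
[cite: BlaserIkenmeyerLysikovPandeySchreyer2019, §6.1 (definition of T_{k,n,r})] -/
def tPrimeEntryO (n k r N p : ℕ) : ℤ :=
  if p / N % N = p % N ∧ ((p / N ^ 2 = 0 ∧ p / N % N < r) ∨
    (1 ≤ p / N ^ 2 ∧ p / N ^ 2 < k ∧ r + p / N ^ 2 * n ≤ p / N % N + n ∧ p / N % N < r + p / N ^ 2 * n))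
  then 1 else 0

/-- The cube size `N = k n + r` of an instance `(n, k, l, r)`. [cite: BlaserIkenmeyerLysikovPandeySchreyer2019, Cor. 37 (proof)] -/
def cubeSize (x : ℕ × ℕ × List ℤ × ℕ) : ℕ := x.2.1 * x.1 + x.2.2.2

/-- **The `OCC` instance of an `HMinRank` instance `(n, k, l, r)`**: `(N, t, t')`.
[cite: BlaserIkenmeyerLysikovPandeySchreyer2019, Cor. 37 (proof)] -/
def instO (x : ℕ × ℕ × List ℤ × ℕ) : ℕ × List ℤ × List ℤ :=
  (cubeSize x, (List.range (cubeSize x ^ 3)).map (tEntryO x.1 x.2.1 x.2.2.1 (cubeSize x)),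
    (List.range (cubeSize x ^ 3)).map (tPrimeEntryO x.1 x.2.1 x.2.2.2 (cubeSize x)))

/-- The fixed non-member of `OCC`: cube size `1` with empty entry lists (ill-formed).
[cite: BlaserIkenmeyerLysikovPandeySchreyer2019, Cor. 37] -/
def badO : ℕ × List ℤ × List ℤ := (1, [], [])

/-- **The instance map `HMinRank1 → OCC`** on all instances (guard `guardA` of the Thm 34 file:
well-formed entry list, `r = 1`, `k ≥ 1`). [cite: BlaserIkenmeyerLysikovPandeySchreyer2019, Cor. 37 (proof)] -/
def reduceO (x : ℕ × ℕ × List ℤ × ℕ) : ℕ × List ℤ × List ℤ :=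
  if BILPS19Thm34.guardA x then instO x else badO

/-- `badO ∉ OCC`. [cite: BlaserIkenmeyerLysikovPandeySchreyer2019, Cor. 37] -/
theorem badO_not_mem : badO ∉ occSet F := fun h => by simp [badO, occSet] at h

/-- Items of a tabulated list. [folklore] -/
private theorem getD_map_range (f : ℕ → ℤ) {m q : ℕ} (hq : q < m) : ((List.range m).map f).getD q 0 = f q := by
  rw [List.getD_eq_getElem _ _ (by simpa using hq)]
  simp

/-- Flat positions of the cube are in range. [folklore] -/
private theorem pos_lt {N : ℕ} (a b c : Fin N) : a.1 * N ^ 2 + b.1 * N + c.1 < N ^ 3 := by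
  have ha := a.2; have hb := b.2; have hc := c.2
  have h1 : a.1 * N + b.1 + 1 ≤ N * N := by nlinarith
  nlinarith

/-- Flat positions of the cube decode. [folklore] -/
private theorem pos_decode {N : ℕ} (a b c : Fin N) :
    (a.1 * N ^ 2 + b.1 * N + c.1) / N ^ 2 = a.1 ∧ (a.1 * N ^ 2 + b.1 * N + c.1) / N % N = b.1 ∧
      (a.1 * N ^ 2 + b.1 * N + c.1) % N = c.1 := by
  have hN : 0 < N := by have := c.2; omega
  have hp : a.1 * N ^ 2 + b.1 * N + c.1 = c.1 + (a.1 * N + b.1) * N := by ring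
  have hdiv : (a.1 * N ^ 2 + b.1 * N + c.1) / N = a.1 * N + b.1 := by
    rw [hp, Nat.add_mul_div_right _ _ hN, Nat.div_eq_of_lt c.2, Nat.zero_add]
  refine ⟨?_, ?_, ?_⟩
  · have h2 : (a.1 * N ^ 2 + b.1 * N + c.1) / N ^ 2 = (a.1 * N ^ 2 + b.1 * N + c.1) / N / N := by
      rw [Nat.div_div_eq_div_mul, ← pow_two]
    rw [h2, hdiv, Nat.add_comm, Nat.add_mul_div_right _ _ hN, Nat.div_eq_of_lt b.2, Nat.zero_add]
  · rw [hdiv, Nat.add_comm, Nat.add_mul_mod_self_right, Nat.mod_eq_of_lt b.2]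
  · rw [hp, Nat.add_mul_mod_self_right, Nat.mod_eq_of_lt c.2]

/-- **The first table is the first cube.** [cite: BlaserIkenmeyerLysikovPandeySchreyer2019, Cor. 37 (proof)] -/
theorem cubeOfList_tTable (n k r : ℕ) (l : List ℤ) :
    cubeOfList F (k * n + r) ((List.range ((k * n + r) ^ 3)).map (tEntryO n k l (k * n + r))) =
      padCube F (k * n + r) k n (hmrTensorOfList F n k l) := by
  funext a b c
  obtain ⟨h1, h2, h3⟩ := pos_decode a b c
  unfold cubeOfList padCube
  rw [getD_map_range _ (pos_lt a b c), tEntryO, h1, h2, h3]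
  by_cases h : a.1 < k ∧ b.1 < n ∧ c.1 < n
  · rw [if_pos h, dif_pos h]; rfl
  · rw [if_neg h, dif_neg h, Int.cast_zero]

/-- **The second table is the second cube.** [cite: BlaserIkenmeyerLysikovPandeySchreyer2019, Cor. 37 (proof)] -/
theorem cubeOfList_tPrimeTable (n k r : ℕ) :
    cubeOfList F (k * n + r) ((List.range ((k * n + r) ^ 3)).map (tPrimeEntryO n k r (k * n + r))) =
      tPrimeCube F (k * n + r) k n r := by
  funext a b c
  obtain ⟨h1, h2, h3⟩ := pos_decode a b c
  unfold cubeOfList tPrimeCube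
  rw [getD_map_range _ (pos_lt a b c), tPrimeEntryO, h1, h2, h3]
  split_ifs <;> simp

/-- **Correctness of the instance map**: `(n, k, l, r)` is a yes-instance of `HMinRank1` iff its
image is a yes-instance of `OCC`. [cite: BlaserIkenmeyerLysikovPandeySchreyer2019, Cor. 37 (proof)] -/
theorem mem_hmr1Set_iff_reduceO_mem [IsAlgClosed F] (x : ℕ × ℕ × List ℤ × ℕ) :
    x ∈ BILPS19Thm34.hmr1Set F ↔ reduceO x ∈ occSet F := by
  obtain ⟨n, k, l, r⟩ := x
  unfold reduceO
  by_cases hg : BILPS19Thm34.guardA (n, k, l, r) = true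
  · rw [if_pos hg]
    simp only [BILPS19Thm34.guardA, Bool.and_eq_true, decide_eq_true_eq, Bool.not_eq_true',
      decide_eq_false_iff_not] at hg
    obtain ⟨⟨hwf, hr⟩, hk⟩ := hg
    simp only [BILPS19Thm34.hmr1Set, occSet, instO, cubeSize, Set.mem_setOf_eq, HMRWellFormed, hwf, hr,
      true_and, List.length_map, List.length_range, cubeOfList_tTable, cubeOfList_tPrimeTable]
    exact mem_minrankSet_iff_orbitClosure3_padCube_subset (Nat.pos_of_ne_zero hk) 1 _
  · rw [if_neg hg]
    refine ⟨fun h => (hg ?_).elim, fun h => (badO_not_mem h).elim⟩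
    obtain ⟨hwf, hr, y, hy, -⟩ := h
    simp only [BILPS19Thm34.guardA, Bool.and_eq_true, decide_eq_true_eq, Bool.not_eq_true',
      decide_eq_false_iff_not]
    refine ⟨⟨hwf, hr⟩, fun hk => hy ?_⟩
    dsimp only at hk y ⊢
    subst hk
    exact Subsingleton.elim _ _

end Reduction

/-! ### §8. The machine: the instance map on codes, in the typed `CodeFP` algebra -/

section Machine

open CodeFP Brick CanonCode BILPS19Thm34

/-- The code of an `OCC` instance, in the `CodeFP` encoders. [cite: AroraBarak2009, §0.1] -/
def occE : ℕ × List ℤ × List ℤ → List Bool := pairE natE (pairE (listE smE) (listE smE))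

/-- `occE` is `occInstEncoding.encode`. [cite: AroraBarak2009, §0.1] -/
theorem occE_eq : (occInstEncoding.encode : ℕ × List ℤ × List ℤ → List Bool) = occE := by
  unfold occE occInstEncoding smE
  rw [pairE_eq, pairE_eq, listE_eq, natE_eq]

/-- The unary loop budget `(|l| + 1)³` (it dominates `N³` when `|l| = k n²`, `r = 1`).
[cite: AroraBarak2009, §1.3 (polynomially bounded loops)] -/
def budgetO (x : ℕ × ℕ × List ℤ × ℕ) : ℕ := (x.2.2.1.length + 1) ^ 3

/-- The instance tabulated under a budget `B` (equal to `instO` under the guard for `B = budgetO`).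
[cite: AroraBarak2009, §1.3] -/
def instOC (x : ℕ × ℕ × List ℤ × ℕ) (B : ℕ) : ℕ × List ℤ × List ℤ :=
  (cubeSize x, (List.range (min (cubeSize x ^ 3) B)).map (tEntryO x.1 x.2.1 x.2.2.1 (cubeSize x)),
    (List.range (min (cubeSize x ^ 3) B)).map (tPrimeEntryO x.1 x.2.1 x.2.2.2 (cubeSize x)))

/-- Under the guard the budget dominates the loop bound, so the capped tables are the tables. [folklore] -/
private theorem instOC_eq {x : ℕ × ℕ × List ℤ × ℕ} (hg : guardA x = true) : instOC x (budgetO x) = instO x := by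
  obtain ⟨n, k, l, r⟩ := x
  simp only [guardA, Bool.and_eq_true, decide_eq_true_eq, Bool.not_eq_true', decide_eq_false_iff_not] at hg
  obtain ⟨⟨hwf, hr⟩, -⟩ := hg
  have hB : cubeSize (n, k, l, r) ^ 3 ≤ budgetO (n, k, l, r) := by
    simp only [cubeSize, budgetO, hwf, hr]
    refine Nat.pow_le_pow_left ?_ 3
    rcases Nat.eq_zero_or_pos n with rfl | hn
    · simp
    · have : k * n ≤ k * n ^ 2 := by rw [pow_two]; exact Nat.mul_le_mul_left _ (Nat.le_mul_of_pos_left n hn)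
      omega
  simp only [instOC, instO, min_eq_left hB]

/-- The context of a cube entry: `((n, k, l, r), p)` — instance and flat position. [cite: AroraBarak2009, §1.3] -/
abbrev octxE : (ℕ × ℕ × List ℤ × ℕ) × ℕ → List Bool := pairE instE natE

/-- The cube size on codes. [cite: AroraBarak2009, §1.3] -/
theorem cubeSizeFP : CodeFP instE natE cubeSize :=
  (natAdd.comp ((natMul.comp ((snd _ _).fst'.pair (fst _ _))).pair (snd _ _).snd'.snd')).congr fun _ => rfl

/-- **The first table on codes** (the entry `A_a[b,c]` read by `rawGetOr`, or `0`).
[cite: BlaserIkenmeyerLysikovPandeySchreyer2019, Cor. 37 (proof)] [cite: AroraBarak2009, §1.3] -/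
theorem tEntryOFP : CodeFP octxE smE (fun c => tEntryO c.1.1 c.1.2.1 c.1.2.2.1 (cubeSize c.1) c.2) := by
  have hx : CodeFP octxE instE (fun c => c.1) := fst _ _
  have hn : CodeFP octxE natE (fun c => c.1.1) := hx.fst'
  have hk : CodeFP octxE natE (fun c => c.1.2.1) := hx.snd'.fst'
  have hl : CodeFP octxE (rawE smE) (fun c => c.1.2.2.1) := ((rawOfList smE).comp hx.snd'.snd'.fst').congr fun _ => rfl
  have hN : CodeFP octxE natE (fun c => cubeSize c.1) := cubeSizeFP.comp hx
  have hp : CodeFP octxE natE (fun c => c.2) := snd _ _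
  have ha : CodeFP octxE natE (fun c => c.2 / cubeSize c.1 ^ 2) := natDiv.comp (hp.pair (natPow.comp (hN.pair (const _ 2))))
  have hb : CodeFP octxE natE (fun c => c.2 / cubeSize c.1 % cubeSize c.1) := natMod.comp ((natDiv.comp (hp.pair hN)).pair hN)
  have hc : CodeFP octxE natE (fun c => c.2 % cubeSize c.1) := natMod.comp (hp.pair hN)
  have hcond : CodeFP octxE bitE (fun c => decide (c.2 / cubeSize c.1 ^ 2 < c.1.2.1) &&
      decide (c.2 / cubeSize c.1 % cubeSize c.1 < c.1.1) && decide (c.2 % cubeSize c.1 < c.1.1)) :=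
    ((natLt.comp (ha.pair hk)).and (natLt.comp (hb.pair hn))).and (natLt.comp (hc.pair hn))
  have hget : CodeFP octxE smE (fun c => c.1.2.2.1.getD (c.2 / cubeSize c.1 ^ 2 * c.1.1 ^ 2 +
      c.2 / cubeSize c.1 % cubeSize c.1 * c.1.1 + c.2 % cubeSize c.1) 0) :=
    ((rawGetOr smE).comp (hl.pair ((natAdd.comp ((natAdd.comp ((natMul.comp (ha.pair (natPow.comp
      (hn.pair (const _ 2))))).pair (natMul.comp (hb.pair hn)))).pair hc)).pair (const _ (0 : ℤ))))).congr
      fun _ => rfl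
  refine (hcond.ite hget (const _ (0 : ℤ))).congr fun c => ?_
  simp only [tEntryO, Bool.and_eq_true, decide_eq_true_eq, and_assoc]

/-- **The second table on codes** (a Boolean formula in the decoded position).
[cite: BlaserIkenmeyerLysikovPandeySchreyer2019, §6.1 (definition of T_{k,n,r})] [cite: AroraBarak2009, §1.3] -/
theorem tPrimeEntryOFP : CodeFP octxE smE (fun c => tPrimeEntryO c.1.1 c.1.2.1 c.1.2.2.2 (cubeSize c.1) c.2) := by
  have hx : CodeFP octxE instE (fun c => c.1) := fst _ _
  have hn : CodeFP octxE natE (fun c => c.1.1) := hx.fst'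
  have hk : CodeFP octxE natE (fun c => c.1.2.1) := hx.snd'.fst'
  have hr : CodeFP octxE natE (fun c => c.1.2.2.2) := hx.snd'.snd'.snd'
  have hN : CodeFP octxE natE (fun c => cubeSize c.1) := cubeSizeFP.comp hx
  have hp : CodeFP octxE natE (fun c => c.2) := snd _ _
  have ha : CodeFP octxE natE (fun c => c.2 / cubeSize c.1 ^ 2) := natDiv.comp (hp.pair (natPow.comp (hN.pair (const _ 2))))
  have hb : CodeFP octxE natE (fun c => c.2 / cubeSize c.1 % cubeSize c.1) := natMod.comp ((natDiv.comp (hp.pair hN)).pair hN)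
  have hc : CodeFP octxE natE (fun c => c.2 % cubeSize c.1) := natMod.comp (hp.pair hN)
  have han : CodeFP octxE natE (fun c => c.1.2.2.2 + c.2 / cubeSize c.1 ^ 2 * c.1.1) :=
    natAdd.comp (hr.pair (natMul.comp (ha.pair hn)))
  have hcond : CodeFP octxE bitE (fun c => decide (c.2 / cubeSize c.1 % cubeSize c.1 = c.2 % cubeSize c.1) &&
      ((decide (c.2 / cubeSize c.1 ^ 2 = 0) && decide (c.2 / cubeSize c.1 % cubeSize c.1 < c.1.2.2.2)) ||
        (decide (1 ≤ c.2 / cubeSize c.1 ^ 2) && decide (c.2 / cubeSize c.1 ^ 2 < c.1.2.1) &&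
          decide (c.1.2.2.2 + c.2 / cubeSize c.1 ^ 2 * c.1.1 ≤ c.2 / cubeSize c.1 % cubeSize c.1 + c.1.1) &&
          decide (c.2 / cubeSize c.1 % cubeSize c.1 < c.1.2.2.2 + c.2 / cubeSize c.1 ^ 2 * c.1.1)))) :=
    (natEq.comp (hb.pair hc)).and (((natEq.comp (ha.pair (const _ 0))).and (natLt.comp (hb.pair hr))).or
      ((((natLe.comp ((const _ 1).pair ha)).and (natLt.comp (ha.pair hk))).and
        (natLe.comp (han.pair (natAdd.comp (hb.pair hn))))).and (natLt.comp (hb.pair han))))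
  refine (hcond.ite (const _ (1 : ℤ)) (const _ (0 : ℤ))).congr fun c => ?_
  simp only [tPrimeEntryO, Bool.and_eq_true, Bool.or_eq_true, decide_eq_true_eq, and_assoc]

/-- **The unary budget on codes.** [cite: AroraBarak2009, §1.3] -/
theorem budgetOFP : CodeFP instE (rawE unitE) (fun x => List.replicate (budgetO x) ()) :=
  ((unitsPow 3).comp (unSucc.comp ((ulength smE).comp ((rawOfList smE).comp
    (snd _ _).snd'.fst')))).congr fun _ => rfl

/-- **The capped instance on codes.** [cite: BlaserIkenmeyerLysikovPandeySchreyer2019, Cor. 37 (proof)] [cite: AroraBarak2009, §1.3] -/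
theorem instOCFP : CodeFP instE occE (fun x => instOC x (List.replicate (budgetO x) ()).length) := by
  have hN : CodeFP instE natE cubeSize := cubeSizeFP
  have hrange : CodeFP instE (rawE natE)
      (fun x => List.range (min (cubeSize x ^ 3) (List.replicate (budgetO x) ()).length)) :=
    (brange unitE).comp (budgetOFP.pair (natPow.comp (hN.pair (const _ 3))))
  have ht : CodeFP instE (listE smE) (fun x => (List.range (min (cubeSize x ^ 3)
      (List.replicate (budgetO x) ()).length)).map (tEntryO x.1 x.2.1 x.2.2.1 (cubeSize x))) :=
    ((listOfRaw smE).comp ((CodeFP.map tEntryOFP).comp ((CodeFP.id _).pair hrange))).congr fun _ => rfl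
  have ht' : CodeFP instE (listE smE) (fun x => (List.range (min (cubeSize x ^ 3)
      (List.replicate (budgetO x) ()).length)).map (tPrimeEntryO x.1 x.2.1 x.2.2.2 (cubeSize x))) :=
    ((listOfRaw smE).comp ((CodeFP.map tPrimeEntryOFP).comp ((CodeFP.id _).pair hrange))).congr fun _ => rfl
  exact (hN.pair (ht.pair ht')).congr fun _ => rfl

/-- **The instance map `reduceO` is computed on codes by a polynomial-time string function.**
[cite: BlaserIkenmeyerLysikovPandeySchreyer2019, Cor. 37] [cite: AroraBarak2009, §1.3] -/
theorem reduceOFP : CodeFP instE occE reduceO := by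
  refine ((guardAFP.ite instOCFP (const _ badO)).congr fun x => ?_)
  unfold reduceO
  by_cases h : guardA x = true
  · rw [if_pos h, if_pos h, List.length_replicate, instOC_eq h]
  · rw [if_neg h, if_neg h]

end Machine

/-! ### §9. `HMinRank1 ≤ₚ OCC`, and the discharge of Cor 37 -/

section Result

variable (F : Type u) [Field F]

/-- **`HMinRank1_{ℤ,F} ≤ₚ OCC_F`** for every algebraically closed field `F`: the Karp map of Cor 37
("minrank varieties can be written as orbit closures", cubic format) on codes, non-codes going to a
fixed non-member. [cite: BlaserIkenmeyerLysikovPandeySchreyer2019, Cor. 37 (proof)] -/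
theorem hmr1Language_karpReducible_occLanguage [IsAlgClosed F] : hmr1Language F ≤ₚ occLanguage F := by
  rw [BILPS19Thm34.hmr1Language_eq, occLanguage_eq]
  refine BILPS19Thm34.karpReducible_of_decoder tensorInstEncoding occInstEncoding
    (dec := BILPS19Thm34.decT) (fun x => ?_) ?_ (g := reduceO) ?_ (mem_hmr1Set_iff_reduceO_mem (F := F))
    badO_not_mem
  · rw [BILPS19Thm34.instE_eq]; exact BILPS19Thm34.decT_instE x
  · rw [BILPS19Thm34.instE_eq]; exact BILPS19Thm34.decT_codeFP
  · rw [BILPS19Thm34.instE_eq, occE_eq]; exact reduceOFP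

/-- **Orbit closure containment is NP-hard over EVERY algebraically closed field** (no
characteristic hypothesis: Cor 35 holds over every field and the orbit-closure dictionary is
characteristic-free) — the statement-file fact `BILPS2019_cor37` carries `[CharZero F]` as printed
in §8.2's standing "characteristic `0`" context for Thm 36, which this route does not use.
[cite: BlaserIkenmeyerLysikovPandeySchreyer2019, Cor. 37] -/
theorem occLanguage_isNPHard [IsAlgClosed F] : IsNPHard (occLanguage F) :=
  IsHard.of_reducible_holds (BILPS2019_cor35_holds F) (hmr1Language_karpReducible_occLanguage F)

end Result

end BILPS2019Cor37

section Discharge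

variable (F : Type u) [Field F]

/-- **Discharge of `BILPS2019_cor37`** (BILPS Cor 37: "Given two tensors `t` and `t'`, deciding
whether the orbit closure of `t` is contained in the orbit closure of `t'` (under the usual
`GL_n × GL_n × GL_n` action) is NP-hard", here for integer cubic tensors read in any algebraically
closed field `F` of characteristic `0`, as typed): `HMinRank1` is NP-hard (`BILPS2019_cor35_holds`, the
printed "minrank problem is NP-hard") and reduces to `occLanguage F`
(`BILPS2019Cor37.hmr1Language_karpReducible_occLanguage`, the printed "minrank varieties can be
written as orbit closures", Thm 19 / Cor 20, read in the cubic format), hardness propagating along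
`≤ₚ` (`IsHard.of_reducible_holds`). [cite: BlaserIkenmeyerLysikovPandeySchreyer2019, Cor. 37] -/
theorem BILPS2019_cor37_holds [IsAlgClosed F] [CharZero F] : BILPS2019_cor37 F :=
  BILPS2019Cor37.occLanguage_isNPHard F

end Discharge

end Literature.Barriers.ValiantsHypothesis
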